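import Summits.BirchSwinnertonDyer.Uniform.UI.O2RegulatorForm
import Summits.BirchSwinnertonDyer.Uniform.UI.O2SigmaValuation
import HarnessLib

/-!
# Uniform/UI/O2 — the per-pair CERTIFICATE and the CONJECTURE on one axis: the `3`-adic unit `U(P)`

HONEST FRAMING (cell `bsd-uniform`, seat `ui-o2`, gen 7): THEOREMS ONLY about the objects of
`Uniform/UI/O2.lean` (the Tate–sigma value `Σ²_E(P) = tateSigmaValueSq`, SW's height (4.1)
`heightFourOneCoord`, the lever's per-pair input `RegulatorNonvanishingAt W 3`); no definition, no
named fact, no `sorry`; the conjecture `TateSigmaIrrationalAtThree` ("C4") is assumed NOWHERE and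
stays OPEN; nothing here proves BSD for any curve, books anything or moves a census mark (D7 of the
cell's PLAN: no compute, no route, no statement change).

What this file adds. Gen 5 proved that `U(P) := Σ²_E(P)/den x(P)` is a `3`-adic UNIT with
`ĥ₃(P) = −log₃ U(P)` (`O2SigmaValuation.lean`). On that axis the census's per-pair certificate and
the seat's conjecture are NESTED exclusion statements about the same unit:

  Schneider / REG3 certificate   `U(P) ∉ μ(ℚ₃) = {±1}`
  C4  (`TateSigmaIrrationalAtThree`)   `U(P) ∉ ℚ`
  C4⁺ (`TateSigmaTranscendentalAtThree`)   `U(P) ∉ ℚ̄`.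

* §0 `eq_or_eq_neg_of_norm_eq_one_of_padicLog_eq`: two `3`-adic units with the same Iwasawa
  logarithm agree up to sign (`ker log₃ ∩ ℤ₃ˣ = {±1}`).
* §1 `heightFourOneCoord_eq_zero_iff`: for `W` globally minimal multiplicative at `3`, `‖q‖ < 1`,
  and a rational point with `‖x‖₃ > 1`: **`ĥ₃(P) = 0 ⟺ Σ²_E(P) = ± den x(P)`** (`U(P) = ±1`).
  Schneider's hypothesis at the point excludes exactly TWO values of `Σ²`; C4 excludes `ℚ`.
* §2 THE CERTIFICATE ON THE AXIS (`regulatorNonvanishingAt_three_iff_forall_admissible`,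
  `regulatorNonvanishingAt_three_iff_exists_admissible`): for `W` globally minimal, NON-split
  multiplicative at `3`, of Mordell–Weil rank ONE (pocket O2's lever locus, `r_an = 1`):
  **`RegulatorNonvanishingAt W 3 ⟺ Σ²_E(P) ≠ ±den x(P)` at EVERY admissible point
  `⟺` at SOME admissible point** (THE height datum exists by the tree theorem
  `exists_isMultCanonical_holds`; the Tate parameter is unique, `existsUnique_tateJ_eq_holds`). So
  the x11b3 REG3 row of a curve ("`Reg₃ ≠ 0` to 3-adic precision") certifies literally
  "`U(Q) ≢ ±1`" at its one admissible point `Q`, and C4 replaces `{±1}` by `ℚ` — the kernel form of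
  the write-up's sentence "stronger than Schneider-at-the-point by exactly the thin set
  `Σ² ∈ ℚˣ ∖ ±3^ℤ·den x`" (here sharpened: a rational `Σ²` off `±den x` is the WHOLE gap).
* §3 TIGHTNESS of the admissibility clause `P ∈ Ê(3ℤ₃)` (`‖x‖₃ > 1`):
  `tateSigmaValueSq_eq_zero_of_x_eq_zero` — at ANY rational point with `x = 0` the transcription
  gives `Σ² = 0 ∈ ℚ` (`log_E(0) = 0`, `ch(0) = 1`, `σ² = 2(1 − 1)·Π = 0`), so C4's conclusion FAILS
  there; such points are never admissible (`not_isAdmissible_three_of_x_eq_zero`). The clause is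
  not idle, and "junk off the admissible locus" (docstring of `tateSigmaValueSq`) has a witness.

* §4 (appended) `tateSigmaValueSq_negY`: **`Σ²` is EVEN, exactly** — `Σ²_W(−P) = Σ²_W(P)` for
  non-torsion rational `P` with `‖x‖_p > 1`, any `p`, `q` (`log_E(z(−P)) = −log_E(z(P))`,
  `padicFormalLog_param_negY`); so `U(−P) = U(P)` with the sign pinned (the lattice laws give `±`).

Not here: the one-point RADICAL form of C4 in rank one and the quadratic law `U(nP) = ±U(P)^{n²}`
(companion file `O2UnitLattice.lean`, same generation); the split prime (`heightSplitCoord`, x11b3's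
residue); anything at `p ≠ 3` beyond §3–§4.

References: [SteinWuthrich2013] §4.1 eq. (4.1), §4.2, Conj. 4.1; [Schneider1982PadicHeightI] §1;
[MazurSteinTate2006] Conj. 1.1; [Iwasawa1972PadicL] §4.4 (`ker log_p`); [Serre1973] II §3.1
(`μ(ℚ₃) = ±1`); write-up `HOME/ui/O2-CONJECTURE.md` §12 (this generation's record).
-/

noncomputable section

open scoped Classical

namespace Summit.BirchSwinnertonDyer.Uniform.UI.O2

open WeierstrassCurve Literature.NumberTheory.EllipticCurves
open Literature.NumberTheory.EllipticCurves.SteinWuthrich2013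
open Literature.NumberTheory.EllipticCurves.Rank1Residual Summit.BirchSwinnertonDyer.Rank1Residual
open Summit.BirchSwinnertonDyer.Rank1Residual.X11b.ClassClosure

/-! ### §0 Units with the same `log₃` agree up to sign -/

/-- `log₃ (−1) = 0` (`(−1)² = 1`: `−1 ∈ μ(ℚ₃) ⊂ ker log₃`). [cite: Iwasawa1972PadicL, §4.4] -/
theorem padicLog_three_neg_one : padicLog 3 (-1 : ℚ_[3]) = 0 :=
  (padicLog_eq_zero_iff_holds 3 (neg_ne_zero.mpr one_ne_zero)).mpr ⟨0, 2, two_pos, by simp⟩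

/-- **Two `3`-adic units with the same Iwasawa logarithm agree up to sign**: `‖a‖ = ‖b‖ = 1`,
`log₃ a = log₃ b ⟹ a = ±b` (`log₃ (a/b) = 0`, so `a/b ∈ 3^ℤ·μ(ℚ₃)`; a unit in `3^ℤ·{±1}` is `±1`).
[cite: Iwasawa1972PadicL, §4.4] [cite: Serre1973, Ch. II §3.1 Prop. 7] -/
theorem eq_or_eq_neg_of_norm_eq_one_of_padicLog_eq {a b : ℚ_[3]} (ha : ‖a‖ = 1) (hb : ‖b‖ = 1)
    (h : padicLog 3 a = padicLog 3 b) : a = b ∨ a = -b := by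
  have ha0 : a ≠ 0 := norm_pos_iff.mp (by rw [ha]; exact one_pos)
  have hb0 : b ≠ 0 := norm_pos_iff.mp (by rw [hb]; exact one_pos)
  set c : ℚ_[3] := a * b⁻¹ with hc_def
  have hc0 : c ≠ 0 := mul_ne_zero ha0 (inv_ne_zero hb0)
  have hc1 : ‖c‖ = 1 := by rw [hc_def, norm_mul, norm_inv, ha, hb, inv_one, mul_one]
  have hlogc : padicLog 3 c = 0 := by
    rw [hc_def, padicLog_mul_holds 3 ha0 (inv_ne_zero hb0), padicLog_inv_three hb0, h,
      add_neg_cancel]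
  obtain ⟨n, k, hk, hpow⟩ := (padicLog_eq_zero_iff_holds 3 hc0).mp hlogc
  have hw := eq_one_or_eq_neg_one_of_pow_eq_one_padicThree hk hpow
  -- the unit `c` times `3^{-n}` is `±1`, so `n = 0`
  have hnorm : ‖c * ((3 : ℕ) : ℚ_[3]) ^ (-n)‖ = 1 := by
    rcases hw with h1 | h1 <;> rw [h1] <;> simp
  rw [norm_mul, hc1, one_mul, Padic.norm_p_zpow, neg_neg] at hnorm
  have hn : n = 0 := by
    have h30 : (0 : ℝ) < ((3 : ℕ) : ℝ) := by norm_num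
    have h31 : ((3 : ℕ) : ℝ) ≠ 1 := by norm_num
    exact zpow_right_injective₀ h30 h31 (by simpa using hnorm)
  rw [hn, neg_zero, zpow_zero, mul_one] at hw
  have hab : a = c * b := by rw [hc_def, mul_assoc, inv_mul_cancel₀ hb0, mul_one]
  rcases hw with h1 | h1
  · left; rw [hab, h1, one_mul]
  · right; rw [hab, h1, neg_one_mul]

/-! ### §1 Pointwise: `ĥ₃(P) = 0 ⟺ Σ²_E(P) = ±den x(P)` -/

section Pointwise

variable {W : WeierstrassCurve ℚ}

/-- **Schneider's hypothesis at a point, on the `Σ²`-axis.** For `W/ℚ` globally minimal with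
multiplicative reduction at `3`, any `q ∈ ℚ₃` with `‖q‖ < 1`, and any rational affine point
`P = (x, y)` with `‖x‖₃ > 1`: `ĥ₃(P) = heightFourOneCoord W 3 q x y` VANISHES iff the Tate–sigma
value squared is `Σ²_E(P) = den x(P)` or `Σ²_E(P) = −den x(P)` — i.e. iff the unit
`U(P) = Σ²/den x` (gen 5: `norm_tateSigmaValueSq_div_den_eq_one`, `ĥ = −log₃ U`) is `±1`, the torsion
of `ℤ₃ˣ`. So at a point the certificate-shaped input "`ĥ₃(P) ≠ 0`" excludes exactly TWO values of
`Σ²`, the conjecture C4 excludes all of `ℚ`. [cite: SteinWuthrich2013, §4.1 eq. (4.1), §4.2]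
[cite: Schneider1982PadicHeightI, §1] [cite: Iwasawa1972PadicL, §4.4] -/
theorem heightFourOneCoord_eq_zero_iff [W.IsElliptic] [W.IsGloballyMinimal] (hW : Mult W 3)
    {q : ℚ_[3]} (hq : ‖q‖ < 1) {x y : ℚ} (hxy : W.toAffine.Nonsingular x y)
    (hx : 1 < ‖(x : ℚ_[3])‖) :
    heightFourOneCoord W 3 q x y = 0 ↔
      (tateSigmaValueSq W 3 q x y = ((x.den : ℚ) : ℚ_[3]) ∨
        tateSigmaValueSq W 3 q x y = -((x.den : ℚ) : ℚ_[3])) := by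
  have hd0 : ((x.den : ℚ) : ℚ_[3]) ≠ 0 := by exact_mod_cast x.den_nz
  have hU := norm_tateSigmaValueSq_div_den_eq_one (p := 3) (by decide) hW hq hxy hx
  rw [heightFourOneCoord_eq_neg_padicLog_div_den (p := 3) (by decide) hW hq hxy hx, neg_eq_zero]
  constructor
  · intro h0
    have h1 : ‖(1 : ℚ_[3])‖ = 1 := norm_one
    rcases eq_or_eq_neg_of_norm_eq_one_of_padicLog_eq hU h1 (h0.trans padicLog_three_one.symm)
      with h | h
    · left
      rwa [div_eq_iff hd0, one_mul] at h
    · right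
      rw [div_eq_iff hd0] at h
      rw [h, neg_one_mul]
  · rintro (h | h)
    · rw [h, div_self hd0, padicLog_three_one]
    · rw [h, neg_div, div_self hd0, padicLog_three_neg_one]

/-- **The same on THE height datum.** For `Dh` pinned by `IsMultCanonical Dh q` (its quadratic form is
SW's (4.1) on admissible points) and an admissible `P = (x, y)`: `⟨P, P⟩ = 0 ⟺ Σ²_E(P) = ±den x(P)`.
[cite: SteinWuthrich2013, §4.2] [cite: Schneider1982PadicHeightI, §1] -/
theorem pairing_self_eq_zero_iff_of_isMultCanonical [W.IsElliptic] [W.IsGloballyMinimal]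
    (hW : Mult W 3) {q : ℚ_[3]} (hq : ‖q‖ < 1) {Dh : PAdicHeightData W 3}
    (hDh : IsMultCanonical Dh q) {x y : ℚ} {h : W.toAffine.Nonsingular x y}
    (hadm : W.IsAdmissible 3 (.some x y h)) :
    Dh.pairing (.some x y h) (.some x y h) = 0 ↔
      (tateSigmaValueSq W 3 q x y = ((x.den : ℚ) : ℚ_[3]) ∨
        tateSigmaValueSq W 3 q x y = -((x.den : ℚ) : ℚ_[3])) := by
  rw [hDh _ hadm]
  exact heightFourOneCoord_eq_zero_iff hW hq h hadm.2.1

/-- **Corollary (the exact gap between certificate and conjecture at a point).** If `Σ²_E(P)` is not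
rational (C4 at the point) then in particular `Σ² ≠ ±den x`, i.e. `ĥ₃(P) ≠ 0`; conversely
`ĥ₃(P) ≠ 0` leaves every rational value other than `±den x(P)` open. Recorded as the implication
"`Σ² ∉ ℚ ⟹ ĥ₃ ≠ 0`" through §1 (gen 2's `heightFourOneCoord_ne_zero_of_tateSigmaIrrational` is the
global version). [cite: SteinWuthrich2013, §4.2] [cite: Schneider1982PadicHeightI, §1] -/
theorem heightFourOneCoord_ne_zero_of_forall_ne_ratCast [W.IsElliptic] [W.IsGloballyMinimal]
    (hW : Mult W 3) {q : ℚ_[3]} (hq : ‖q‖ < 1) {x y : ℚ} (hxy : W.toAffine.Nonsingular x y)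
    (hx : 1 < ‖(x : ℚ_[3])‖) (hirr : ∀ r : ℚ, tateSigmaValueSq W 3 q x y ≠ (r : ℚ_[3])) :
    heightFourOneCoord W 3 q x y ≠ 0 := by
  intro h0
  rcases (heightFourOneCoord_eq_zero_iff hW hq hxy hx).mp h0 with h | h
  · exact hirr (x.den : ℚ) h
  · exact hirr (-(x.den : ℚ)) (by rw [h, Rat.cast_neg])

end Pointwise

/-! ### §2 The certificate `RegulatorNonvanishingAt W 3` on the axis (rank one, non-split) -/

section Certificate

variable {W : WeierstrassCurve ℚ}

/-- **THE PER-PAIR CERTIFICATE IS "`U(P) ≠ ±1` AT EVERY ADMISSIBLE POINT".** For `W/ℚ` globally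
minimal, NON-split multiplicative at `3`, of Mordell–Weil rank one: the lever's per-pair input
`RegulatorNonvanishingAt W 3` (Schneider's conjecture for the pair: `Reg₃(E, Dh) ≠ 0` for THE §4.2
datum; the split conjunct is vacuous) holds iff for every Tate parameter `q` (`q ≠ 0`, `‖q‖ < 1`,
`j(q) = j(E)`) and every admissible `P = (x, y)`, `Σ²_E(P) ≠ den x(P)` and `Σ²_E(P) ≠ −den x(P)`.
(`→`: THE datum exists — tree theorem `exists_isMultCanonical_holds` —, `⟨P, P⟩ = k²·Reg₃` with
`k ≠ 0` for non-torsion `P`, and §1. `←`: `Reg₃ = ⟨P₀, P₀⟩`, an admissible multiple `Q = mP₀` has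
`⟨Q, Q⟩ = m² Reg₃ = ĥ₃(Q) ≠ 0` by §1.) Compare C4 on the curve: `Σ²_E(P) ∉ ℚ` at every admissible `P`.
[cite: Schneider1982PadicHeightI, §1] [cite: SteinWuthrich2013, §4.2, Conj. 4.1]
[cite: MazurSteinTate2006, Conj. 1.1] -/
theorem regulatorNonvanishingAt_three_iff_forall_admissible [W.IsElliptic] [W.IsGloballyMinimal]
    (hW : Mult W 3) (hns : ¬ W.HasSplitMultiplicativeReductionAtPrime 3)
    (hr : W.mordellWeilRank = 1) :
    RegulatorNonvanishingAt W 3 ↔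
      ∀ (q : ℚ_[3]), q ≠ 0 → ‖q‖ < 1 → tateJ q = (W.j : ℚ_[3]) →
      ∀ (x y : ℚ) (h : W.toAffine.Nonsingular x y), W.IsAdmissible 3 (.some x y h) →
        tateSigmaValueSq W 3 q x y ≠ ((x.den : ℚ) : ℚ_[3]) ∧
          tateSigmaValueSq W 3 q x y ≠ -((x.den : ℚ) : ℚ_[3]) := by
  constructor
  · rintro ⟨hReg, -⟩ q hq0 hq1 hj x y h hadm
    obtain ⟨Dh, hDh⟩ := exists_isMultCanonical_holds W 3 (by norm_num) hW hns q hq0 hq1 hj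
    have hS : padicRegulator Dh ≠ 0 := hReg q Dh hq0 hq1 hj hDh
    obtain ⟨P₀, -, hRegeq, hgen⟩ := exists_generator_of_rank_one hr Dh
    obtain ⟨k, hk, hk0⟩ := hgen (.some x y h)
    have hkne : (k : ℚ_[3]) ≠ 0 := by exact_mod_cast fun h0 ↦ hadm.1 (hk0 h0)
    have hne : Dh.pairing (.some x y h) (.some x y h) ≠ 0 := by
      rw [hk, ← hRegeq]
      exact mul_ne_zero (pow_ne_zero 2 hkne) hS
    exact not_or.mp ((pairing_self_eq_zero_iff_of_isMultCanonical hW hq1 hDh hadm).not.mp hne)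
  · intro H
    refine ⟨fun q Dh hq0 hq1 hj hDh ↦ ?_, fun Dq _ _ ↦ absurd Dq.split hns⟩
    obtain ⟨P₀, hP₀, hRegeq, -⟩ := exists_generator_of_rank_one hr Dh
    obtain ⟨m, -, hadm⟩ := exists_admissible_nsmul_holds W 3 P₀ hP₀
    unfold SchneiderConjecture
    rw [hRegeq]
    intro hzero
    have hmm : Dh.pairing (m • P₀) (m • P₀) = 0 := by rw [pairing_nsmul_nsmul, hzero, mul_zero]
    rcases hQ : m • P₀ with _ | ⟨x, y, h⟩
    · rw [hQ] at hadm
      exact hadm.1 IsOfFinAddOrder.zero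
    · rw [hQ] at hadm hmm
      exact not_or.mpr (H q hq0 hq1 hj x y h hadm)
        ((pairing_self_eq_zero_iff_of_isMultCanonical hW hq1 hDh hadm).mp hmm)

/-- **ONE ADMISSIBLE POINT DECIDES THE CERTIFICATE.** Same hypotheses (globally minimal, non-split
multiplicative at `3`, Mordell–Weil rank one): `RegulatorNonvanishingAt W 3` holds iff there EXIST a
Tate parameter `q` and ONE admissible point `P = (x, y)` with `Σ²_E(P) ≠ ±den x(P)` (`U(P) ≠ ±1`).
(`→`: a Tate parameter exists, `existsUnique_tateJ_eq_holds` with `‖j(E)‖₃ > 1`; rank one gives a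
non-torsion point, `exists_admissible_nsmul_holds` an admissible multiple; then the `∀`-form. `←`: the
Tate parameter is UNIQUE, so the given `q` is the one of any datum `Dh`; `⟨P, P⟩ = k²·Reg₃ ≠ 0`
forces `Reg₃ ≠ 0`.) This is the exact content of one x11b3 REG3 certificate row: the canonical
height of ONE admissible point, computed to `3`-adic precision, is not `0` — i.e. `U(Q) ≢ ±1`.
[cite: Schneider1982PadicHeightI, §1] [cite: SteinWuthrich2013, §4.2, §7]
[cite: SilvermanATAEC1994, Lemma V.5.1] -/
theorem regulatorNonvanishingAt_three_iff_exists_admissible [W.IsElliptic] [W.IsGloballyMinimal]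
    (hW : Mult W 3) (hns : ¬ W.HasSplitMultiplicativeReductionAtPrime 3)
    (hr : W.mordellWeilRank = 1) :
    RegulatorNonvanishingAt W 3 ↔
      ∃ (q : ℚ_[3]), q ≠ 0 ∧ ‖q‖ < 1 ∧ tateJ q = (W.j : ℚ_[3]) ∧
      ∃ (x y : ℚ) (h : W.toAffine.Nonsingular x y), W.IsAdmissible 3 (.some x y h) ∧
        tateSigmaValueSq W 3 q x y ≠ ((x.den : ℚ) : ℚ_[3]) ∧
          tateSigmaValueSq W 3 q x y ≠ -((x.den : ℚ) : ℚ_[3]) := by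
  have hj1 : 1 < ‖(W.j : ℚ_[3])‖ := one_lt_norm_j_of_hasMultiplicativeReductionAtPrime hW
  constructor
  · intro hR
    have hall := (regulatorNonvanishingAt_three_iff_forall_admissible hW hns hr).mp hR
    obtain ⟨q, ⟨hq0, hq1, hj⟩, -⟩ := existsUnique_tateJ_eq_holds 3 hj1
    obtain ⟨Dh, _hDh⟩ := exists_isMultCanonical_holds W 3 (by norm_num) hW hns q hq0 hq1 hj
    obtain ⟨P₀, hP₀, -, -⟩ := exists_generator_of_rank_one hr Dh
    obtain ⟨m, -, hadm⟩ := exists_admissible_nsmul_holds W 3 P₀ hP₀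
    rcases hQ : m • P₀ with _ | ⟨x, y, h⟩
    · rw [hQ] at hadm
      exact absurd IsOfFinAddOrder.zero hadm.1
    · rw [hQ] at hadm
      exact ⟨q, hq0, hq1, hj, x, y, h, hadm, hall q hq0 hq1 hj x y h hadm⟩
  · rintro ⟨q₀, hq0, hq1, hj, x, y, h, hadm, hne⟩
    refine ⟨fun q Dh hq0' hq1' hj' hDh ↦ ?_, fun Dq _ _ ↦ absurd Dq.split hns⟩
    have hqq : q = q₀ :=
      (existsUnique_tateJ_eq_holds 3 hj1).unique ⟨hq0', hq1', hj'⟩ ⟨hq0, hq1, hj⟩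
    subst hqq
    obtain ⟨P₀, -, hRegeq, hgen⟩ := exists_generator_of_rank_one hr Dh
    obtain ⟨k, hk, -⟩ := hgen (.some x y h)
    have hPP : Dh.pairing (.some x y h) (.some x y h) ≠ 0 :=
      (pairing_self_eq_zero_iff_of_isMultCanonical hW hq1 hDh hadm).not.mpr (not_or.mpr hne)
    unfold SchneiderConjecture
    rw [hRegeq]
    intro hzero
    exact hPP (by rw [hk, hzero, mul_zero])

/-- **C4 on a curve ⟹ the certificate, through the axis** (`ℚ ⊃ {±1}`): for `W` globally minimal,
non-split multiplicative at `3`, rank one, if `Σ²_E(P) ∉ ℚ` at every admissible point of every Tate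
parameter then `RegulatorNonvanishingAt W 3`. (Gen 2's `regulatorNonvanishingAt_three_of_tateSigmaIrrational`
is this with the hypothesis supplied by `TateSigmaIrrationalAtThree`; recorded here as the instance
"exclude `ℚ`" ⟹ "exclude `±1`" of §2.) [cite: Schneider1982PadicHeightI, §1] [cite: SteinWuthrich2013, §4.2] -/
theorem regulatorNonvanishingAt_three_of_forall_admissible_ne_ratCast [W.IsElliptic]
    [W.IsGloballyMinimal] (hW : Mult W 3) (hns : ¬ W.HasSplitMultiplicativeReductionAtPrime 3)
    (hr : W.mordellWeilRank = 1)
    (HW : ∀ (q : ℚ_[3]), q ≠ 0 → ‖q‖ < 1 → tateJ q = (W.j : ℚ_[3]) →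
      ∀ (x y : ℚ) (h : W.toAffine.Nonsingular x y), W.IsAdmissible 3 (.some x y h) →
        ∀ r : ℚ, tateSigmaValueSq W 3 q x y ≠ (r : ℚ_[3])) :
    RegulatorNonvanishingAt W 3 := by
  refine (regulatorNonvanishingAt_three_iff_forall_admissible hW hns hr).mpr
    fun q hq0 hq1 hj x y h hadm ↦ ⟨?_, ?_⟩
  · have := HW q hq0 hq1 hj x y h hadm x.den
    push_cast at this
    exact this
  · have := HW q hq0 hq1 hj x y h hadm (-(x.den : ℚ))
    push_cast at this
    exact this

end Certificate

/-! ### §3 Tightness of the admissibility clause `‖x‖₃ > 1` -/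

section Tightness

/-- `ch(0) = 1` (`Σ 0ⁿ/(2n)!`: only the `n = 0` term survives). [folklore] -/
theorem coshOfSq_zero {K : Type*} [NormedField K] : coshOfSq (0 : K) = 1 := by
  unfold coshOfSq
  rw [tsum_eq_single 0 (fun n hn ↦ by rw [zero_pow hn, zero_div])]
  simp

/-- `σ_q²` at `c = 1` (`u = 1`) vanishes: `2(c − 1)·Π = 0`. [cite: SteinWuthrich2013, §4.2] -/
theorem tateSigmaSq_one {K : Type*} [NormedField K] (q : K) : tateSigmaSq q 1 = 0 := by
  unfold tateSigmaSq
  rw [sub_self, mul_zero, zero_mul]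

/-- **The conclusion of C4 FAILS at every rational point with `x = 0`** (for ANY `W`, prime `p` and
`q`): the transcription gives `z = −0/y = 0`, `log_E(0) = 0`, `log_p(u)² = 0`, `c = ch(0) = 1`,
`σ_q(u)² = 2(1 − 1)·Π = 0`, hence `Σ²_W(0, y) = C²·0 = 0 ∈ ℚ`. Such a point is never admissible
(`not_isAdmissible_three_of_x_eq_zero`): the clause "`P ∈ Ê(3ℤ₃)`" (`‖x‖₃ > 1`) of `IsAdmissible`
carries weight in `TateSigmaIrrationalAtThree`, and the docstring's "junk off the admissible locus"
has an explicit witness. [cite: SteinWuthrich2013, §4.2] -/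
theorem tateSigmaValueSq_eq_zero_of_x_eq_zero (W : WeierstrassCurve ℚ) (p : ℕ) [Fact p.Prime]
    (q : ℚ_[p]) (y : ℚ) : tateSigmaValueSq W p q 0 y = ((0 : ℚ) : ℚ_[p]) := by
  unfold tateSigmaValueSq logUnitParamSq
  rw [Rat.cast_zero, neg_zero, zero_div, padicFormalLog_zero, zero_pow two_ne_zero, zero_div,
    coshOfSq_zero, tateSigmaSq_one, mul_zero]

/-- A rational point with `x = 0` is not admissible at `3` (`‖0‖₃ = 0 ≤ 1` violates the clause
`1 < ‖x‖₃`). [cite: MazurSteinTate2006, §1] -/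
theorem not_isAdmissible_three_of_x_eq_zero (W : WeierstrassCurve ℚ) {y : ℚ}
    (h : W.toAffine.Nonsingular 0 y) : ¬ W.IsAdmissible 3 (.some 0 y h) := by
  intro hadm
  have hx : 1 < ‖((0 : ℚ) : ℚ_[3])‖ := hadm.2.1
  rw [Rat.cast_zero, norm_zero] at hx
  exact absurd hx (not_lt.mpr zero_le_one)

/-- **Hence the unrestricted variant of C4 is FALSE as soon as one curve multiplicative at `3`
carries a rational point with `x = 0`** — stated abstractly: for every `W`, `q` and every
nonsingular rational point `(0, y)` there is a rational `r` (namely `0`) with `Σ²_W(0, y) = r`.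
(Any `W` with `a₆ = 0` carries the rational point `(0, 0)`.) [cite: SteinWuthrich2013, §4.2] -/
theorem exists_ratCast_eq_tateSigmaValueSq_of_x_eq_zero (W : WeierstrassCurve ℚ) (q : ℚ_[3])
    (y : ℚ) : ∃ r : ℚ, tateSigmaValueSq W 3 q 0 y = (r : ℚ_[3]) :=
  ⟨0, tateSigmaValueSq_eq_zero_of_x_eq_zero W 3 q y⟩

end Tightness

/-! ### §4 (appended, same generation) `Σ²` is EVEN: `Σ²_E(−P) = Σ²_E(P)` exactly -/

section Even

variable {W : WeierstrassCurve ℚ}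

/-- **`log_E(z(−P)) = −log_E(z(P))` on the rational points of `E₁(ℚ_p)`.** For `W/ℚ` globally
minimal (hence `ℤ`-integral), a prime `p`, and a NON-TORSION rational point `P = (x, y)` with
`‖x‖_p > 1`: the `p`-adic formal logarithm at `z(−P) = −x/(−y − a₁x − a₃)` is minus the one at
`z(P) = −x/y`. Proof: `2P = (x₂, y₂)` is affine (`P` non-torsion) and in `E₁(ℚ_p)` (a subgroup,
`kernelOfReductionAt`), and `log_E ∘ z` is additive on `E(ℚ) ∩ E₁(ℚ_p)` (`padicFormalLog_param_add`):
`P + P = 2P` and `(−P) + 2P = P`. [cite: SilvermanAEC2009, VII.2.2 and IV.6.4(a)] -/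
theorem padicFormalLog_param_negY [W.IsElliptic] [W.IsGloballyMinimal] (p : ℕ) [Fact p.Prime]
    {x y : ℚ} (h : W.toAffine.Nonsingular x y) (hx : 1 < ‖(x : ℚ_[p])‖)
    (hP : ¬ IsOfFinAddOrder (.some x y h : W.toAffine.Point)) :
    (W.baseChange ℚ_[p]).padicFormalLog (-(x : ℚ_[p]) / (W.toAffine.negY x y : ℚ)) =
      -(W.baseChange ℚ_[p]).padicFormalLog (-(x : ℚ_[p]) / y) := by
  set P : W.toAffine.Point := .some x y h with hP_def
  have hn : W.toAffine.Nonsingular x (W.toAffine.negY x y) :=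
    (WeierstrassCurve.Affine.nonsingular_neg x y).mpr h
  have hneg : -P = .some x (W.toAffine.negY x y) hn := by
    rw [hP_def, WeierstrassCurve.Affine.Point.neg_some]
  -- `2P` is affine and lies in `E₁(ℚ_p)`
  have hPmem : P ∈ W.kernelOfReductionAt p := (some_mem_kernelOfReductionAt_iff h).mpr hx
  have h2mem : (2 : ℕ) • P ∈ W.kernelOfReductionAt p := AddSubgroup.nsmul_mem _ hPmem 2
  have h2ne : (2 : ℕ) • P ≠ 0 := fun h0 ↦
    hP (isOfFinAddOrder_iff_nsmul_eq_zero.mpr ⟨2, two_pos, h0⟩)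
  rcases h2 : (2 : ℕ) • P with _ | ⟨x₂, y₂, h₂⟩
  · exact absurd h2 h2ne
  rw [h2] at h2mem
  have hx₂ : 1 < ‖(x₂ : ℚ_[p])‖ := (some_mem_kernelOfReductionAt_iff h₂).mp h2mem
  -- (a) `P + P = 2P`
  have hPP : P + P = .some x₂ y₂ h₂ := by rw [← two_nsmul, h2]
  have la := padicFormalLog_param_add (p := p) h h h₂ hx hx hPP
  -- (b) `(-P) + 2P = P`
  have hsum : (.some x (W.toAffine.negY x y) hn : W.toAffine.Point) + .some x₂ y₂ h₂ = P := by
    rw [← hneg, ← h2, two_nsmul, neg_add_cancel_left]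
  have lb := padicFormalLog_param_add (p := p) hn h₂ h hx hx₂ hsum
  rw [la] at lb
  linear_combination -lb

/-- **`Σ²` IS EVEN, exactly**: for `W` globally minimal, any prime `p`, any `q`, and a non-torsion
rational `P = (x, y)` with `‖x‖_p > 1`: `Σ²_W(−P) = Σ²_W(P)` (`−P = (x, −y − a₁x − a₃)`; the
transcription sees `P` only through `log_E(z(P))²`, and `log_E(z(−P)) = −log_E(z(P))`). So the unit
`U(−P) = U(P)` with the `+` sign (the quadratic law / torsion translation of §1 give signs only up to
`±`), as befits the SQUARE of the odd sigma function. No multiplicativity at `p` is needed.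
[cite: SteinWuthrich2013, §4.2] [cite: MazurTate1991, §1] -/
theorem tateSigmaValueSq_negY [W.IsElliptic] [W.IsGloballyMinimal] (p : ℕ) [Fact p.Prime]
    (q : ℚ_[p]) {x y : ℚ} (h : W.toAffine.Nonsingular x y) (hx : 1 < ‖(x : ℚ_[p])‖)
    (hP : ¬ IsOfFinAddOrder (.some x y h : W.toAffine.Point)) :
    tateSigmaValueSq W p q x (W.toAffine.negY x y) = tateSigmaValueSq W p q x y := by
  unfold tateSigmaValueSq logUnitParamSq
  rw [padicFormalLog_param_negY p h hx hP, neg_sq]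

/-- **An admissible point and its negative have the same `Σ²`** (and the same `den x`, hence the
same unit `U`): `IsAdmissible` supplies non-torsion and `‖x‖₃ > 1`. [cite: SteinWuthrich2013, §4.2] -/
theorem tateSigmaValueSq_negY_of_isAdmissible [W.IsElliptic] [W.IsGloballyMinimal] (q : ℚ_[3])
    {x y : ℚ} {h : W.toAffine.Nonsingular x y} (hadm : W.IsAdmissible 3 (.some x y h)) :
    tateSigmaValueSq W 3 q x (W.toAffine.negY x y) = tateSigmaValueSq W 3 q x y :=
  tateSigmaValueSq_negY 3 q h hadm.2.1 hadm.1

end Even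

end Summit.BirchSwinnertonDyer.Uniform.UI.O2

end
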